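import Literature.AnabelianGeometry.SemiGraphs.FundamentalGroup
import Literature.GroupTheory.CombinatorialGroupTheory.FreeGroupoidWords
import HarnessLib

/-!
# The rose (bouquet of circles) on an arbitrary index type and its fundamental group ([SemiAnbd] §1, Cor. 1.6)

Mochizuki, *Semi-graphs of anabelioids*, Publ. RIMS **42** (2006), §1, proof of Cor. 1.6 (i)
(A. Tamagawa / Stallings): a free group `Γ` with basis `(x_i)_{i ∈ ι}` is the (topological)
fundamental group of the finite graph `B_ι` with ONE vertex and one loop-edge for each `i ∈ ι`
(the "bouquet", or rose).  In L3-t1's model (`FundamentalGroup.lean`: `π₁` = vertex group of the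
free groupoid on `catQuiver`, one arrow `e → v` per abutting branch) we construct

* `SemiGraph.rose ι` — vertex type `PUnit`, edges `ι`, branches `ι × Bool` (`(i, false)` the
  source branch, `(i, true)` the target branch of the loop `i`), all abutting to the vertex; it is
  a finite graph for finite `ι` (`rose_isGraph`, `rose_isFinite`).  (L3-t1's `SemiGraph.bouquet n`
  of `ZariskiMainTheorem.lean` is the same graph `H_n` of [SemiAnbd] p. 16 indexed by `Fin n` with
  `ULift`s; Cor. 1.6 (i) quantifies over a free basis indexed by an arbitrary `ι : Type u`, so we
  index the petals by `ι` directly — a bridge `rose (ULift (Fin n)) ≅ bouquet n` is immediate and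
  not needed here);
* `Rose.labelFunctor b` — for a map `b : ι → Γ` to a group, the functor from the fundamental
  groupoid to `SingleObj Γ` labelling the target branch of loop `i` by `b i` and the source branch
  by `1` (Mathlib `Quiver.FreeGroupoid.lift`), and the resulting homomorphism
  `Rose.labelHom b : π₁(B_ι, ⋆) →* Γ` (an inverse is inserted because the vertex group composes
  diagrammatically while `SingleObj Γ` composes anti-diagrammatically);
* `Rose.loopHom bΓ : Γ →* π₁(B_ι, ⋆)` for a free basis `bΓ` of `Γ`, sending `bΓ i` to the class
  of the loop `i`, and the proof that `labelHom`/`loopHom` are mutually inverse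
  (`Rose.fundamentalGroupEquiv bΓ : π₁(B_ι, ⋆) ≃* Γ`): every closed zigzag path at `⋆` is a
  product of two-arrow excursions through the edge-objects (the quiver has no other shape).

Elementary; written for the discharge of [SemiAnbd] Cor. 1.6 (i) (`FundamentalGroupProofs.lean`).
-/

namespace Literature.AnabelianGeometry.SemiGraphs

namespace SemiGraph

open CategoryTheory Quiver
open Literature.GroupTheory.CombinatorialGroupTheory
open Literature.GroupTheory.CombinatorialGroupTheory.FreeGroupoidWords

universe u

variable (ι : Type u)

/-- The **rose** (bouquet of circles) `B_ι`: one vertex, one loop-edge `i` for each `i : ι`, with source branch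
`(i, false)` and target branch `(i, true)`, both abutting to the vertex (proof of Cor. 1.6 (i),
p. 19: the graph `G_B` with `π₁(G_B) = G` free). [cite: MochizukiSemiAnbd2006, Cor. 1.6(i) p.19] -/
def rose : SemiGraph.{u} where
  Vertex := PUnit.{u + 1}
  Edge := ι
  Branch := ι × Bool
  edgeOf := Prod.fst
  abuts _ := some PUnit.unit
  two_branches i := ⟨(i, false), (i, true), by simp, rfl, rfl, fun b hb => by
    obtain ⟨j, s⟩ := b
    cases hb
    cases s
    · exact Or.inl rfl
    · exact Or.inr rfl⟩

/-- The bouquet is a graph: every branch abuts to the vertex. [cite: MochizukiSemiAnbd2006, Cor. 1.6(i) p.19] -/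
theorem rose_isGraph : (rose ι).IsGraph := ⟨fun _ => rfl⟩

/-- The bouquet on a finite set is a finite graph. [cite: MochizukiSemiAnbd2006, Cor. 1.6(i) p.19] -/
theorem rose_isFinite [Finite ι] : (rose ι).IsFinite :=
  ⟨inferInstanceAs (Finite PUnit.{u + 1}), ‹Finite ι›⟩

namespace Rose

/-- The vertex `⋆` of the bouquet. [cite: MochizukiSemiAnbd2006, Cor. 1.6(i) p.19] -/
def vtx : (rose ι).Vertex := PUnit.unit

variable {ι} in
/-- The bouquet has only one vertex. [cite: MochizukiSemiAnbd2006, Cor. 1.6(i) p.19] -/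
theorem eq_vtx (v : (rose ι).Vertex) : v = vtx ι := rfl

/-- The base object `⋆` (the vertex) of the symmetrised quiver of the bouquet.
[cite: MochizukiSemiAnbd2006, Cor. 1.6(i) p.19] -/
abbrev base : Symmetrify (rose ι).CatCarrier := Sum.inl (vtx ι)

/-- The edge-object of the loop `i`. [cite: MochizukiSemiAnbd2006, Cor. 1.6(i) p.19] -/
abbrev edgeObj (i : ι) : Symmetrify (rose ι).CatCarrier := Sum.inr i

variable {ι}

/-- The arrow `i → ⋆` of `Cat(B_ι)` given by the branch `(i, s)`.
[cite: MochizukiSemiAnbd2006, Def. 2.11 p.32] -/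
def arrow (i : ι) (s : Bool) :
    @Quiver.Hom (rose ι).CatCarrier _ (Sum.inr i) (Sum.inl (vtx ι)) :=
  ⟨(i, s), rfl, rfl⟩

/-- Every arrow `i → ⋆` of `Cat(B_ι)` is one of the two branch arrows.
[cite: MochizukiSemiAnbd2006, Def. 2.11 p.32] -/
theorem arrow_eq (i : ι) (x : @Quiver.Hom (rose ι).CatCarrier _ (Sum.inr i) (Sum.inl (vtx ι))) :
    x = arrow i x.1.2 := by
  obtain ⟨⟨j, s⟩, hj, h⟩ := x
  cases hj
  rfl

/-- The backward formal arrow `⋆ ⟶ i` of the symmetrised quiver through the branch `(i, s)`.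
[cite: MochizukiSemiAnbd2006, Cor. 1.6(i) p.19] -/
abbrev inArrow (i : ι) (s : Bool) : base ι ⟶ edgeObj ι i := Sum.inr (arrow i s)

/-- The forward formal arrow `i ⟶ ⋆` of the symmetrised quiver through the branch `(i, s)`.
[cite: MochizukiSemiAnbd2006, Cor. 1.6(i) p.19] -/
abbrev outArrow (i : ι) (s : Bool) : edgeObj ι i ⟶ base ι := Sum.inl (arrow i s)

/-- A two-arrow excursion `⋆ ← i → ⋆`: in through the branch `(i, s)`, out through `(i, s')`.
[cite: MochizukiSemiAnbd2006, Cor. 1.6(i) p.19] -/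
def excursion (i : ι) (s s' : Bool) : Path (base ι) (base ι) :=
  ((Path.nil : Path (base ι) (base ι)).cons (inArrow i s)).cons (outArrow i s')

/-- The loop of the generator `i`: in through the target branch, out through the source branch (so
that its label, read anti-diagrammatically and inverted, is `b i`).
[cite: MochizukiSemiAnbd2006, Cor. 1.6(i) p.19] -/
def loopPath (i : ι) : Path (base ι) (base ι) := excursion i true false

/-- The class in `π₁(B_ι, ⋆)` of a closed zigzag path at `⋆`. [cite: MochizukiSemiAnbd2006, Cor. 1.6(i) p.19] -/
def cls (p : Path (base ι) (base ι)) : (rose ι).FundamentalGroup (Sum.inl (vtx ι)) :=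
  homMk (V := (rose ι).CatCarrier) p

/-- `cls` unfolds to d1's `homMk`. [cite: MochizukiSemiAnbd2006, Cor. 1.6(i) p.19] -/
theorem cls_eq (p : Path (base ι) (base ι)) : cls p = homMk (V := (rose ι).CatCarrier) p := rfl

/-- The class of the empty path is `1`. [cite: MochizukiSemiAnbd2006, Cor. 1.6(i) p.19] -/
theorem cls_nil : cls (Path.nil : Path (base ι) (base ι)) = 1 := homMk_nil (V := (rose ι).CatCarrier) _

/-- Concatenation of closed paths is multiplication in `π₁`. [cite: MochizukiSemiAnbd2006, Cor. 1.6(i) p.19] -/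
theorem cls_comp (p q : Path (base ι) (base ι)) : cls (p.comp q) = cls p * cls q :=
  homMk_comp (V := (rose ι).CatCarrier) p q

/-- Every element of `π₁(B_ι, ⋆)` is the class of a closed path. [cite: MochizukiSemiAnbd2006, Cor. 1.6(i) p.19] -/
theorem cls_surjective (x : (rose ι).FundamentalGroup (Sum.inl (vtx ι))) :
    ∃ p : Path (base ι) (base ι), cls p = x :=
  homMk_surjective (V := (rose ι).CatCarrier) x

/-- An excursion in and out through the same branch is trivial.
[cite: MochizukiSemiAnbd2006, Cor. 1.6(i) p.19] -/
theorem cls_excursion_self (i : ι) (s : Bool) : cls (excursion i s s) = 1 :=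
  homMk_toPath_comp_reverse (V := (rose ι).CatCarrier) (inArrow i s)

/-- Reversing the branches of an excursion inverts its class.
[cite: MochizukiSemiAnbd2006, Cor. 1.6(i) p.19] -/
theorem cls_excursion_symm (i : ι) (s s' : Bool) :
    cls (excursion i s' s) = (cls (excursion i s s'))⁻¹ := by
  rw [eq_inv_iff_mul_eq_one, ← cls_comp]
  have e : (excursion i s' s).comp (excursion i s s') =
      (((Path.nil : Path (base ι) (base ι)).cons (inArrow i s')).comp
        ((Quiver.Hom.toPath (outArrow i s)).comp
          (Quiver.Hom.toPath (Quiver.reverse (outArrow i s))))).cons (outArrow i s') := rfl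
  rw [e, cls_eq, homMk_cons, homMk_comp, homMk_toPath_comp_reverse, Category.comp_id, ← homMk_cons]
  exact cls_excursion_self i s'

variable {Γ : Type u} [Group Γ]

/-- The labelling of the arrows of `Cat(B_ι)` by elements of `Γ`: the target branch of loop `i`
carries `b i`, the source branch carries `1`. [cite: MochizukiSemiAnbd2006, Cor. 1.6(i) p.19] -/
def labelPrefunctor (b : ι → Γ) : (rose ι).CatCarrier ⥤q CategoryTheory.SingleObj Γ where
  obj _ := CategoryTheory.SingleObj.star Γ
  map {X Y} x := match X, Y, x with
    | Sum.inr _, Sum.inl _, x => cond x.1.2 (b x.1.1) (1 : Γ)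
    | Sum.inl _, Sum.inl _, x => PEmpty.elim x
    | Sum.inl _, Sum.inr _, x => PEmpty.elim x
    | Sum.inr _, Sum.inr _, x => PEmpty.elim x

/-- The label of a branch arrow. [cite: MochizukiSemiAnbd2006, Cor. 1.6(i) p.19] -/
theorem labelPrefunctor_map_arrow (b : ι → Γ) (i : ι) (s : Bool) :
    (labelPrefunctor b).map (arrow i s) = cond s (b i) (1 : Γ) := rfl

/-- The label functor from the fundamental groupoid of the bouquet to `SingleObj Γ`
(universal property of the free groupoid). [cite: MochizukiSemiAnbd2006, Cor. 1.6(i) p.19] -/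
noncomputable def labelFunctor (b : ι → Γ) :
    (rose ι).FundamentalGroupoid ⥤ CategoryTheory.SingleObj Γ :=
  Quiver.FreeGroupoid.lift (labelPrefunctor b)

/-- The label (in `Γ`, anti-diagrammatic) of the class of a closed path.
[cite: MochizukiSemiAnbd2006, Cor. 1.6(i) p.19] -/
noncomputable def rawLabel (b : ι → Γ) (p : Path (base ι) (base ι)) : Γ :=
  (labelFunctor b).map (cls p)

/-- The raw label of the empty path. [cite: MochizukiSemiAnbd2006, Cor. 1.6(i) p.19] -/
theorem rawLabel_nil (b : ι → Γ) : rawLabel b (Path.nil : Path (base ι) (base ι)) = 1 := by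
  rw [rawLabel, cls_nil]
  exact CategoryTheory.Functor.map_id _ _

/-- The raw label of a concatenation (anti-diagrammatic). [cite: MochizukiSemiAnbd2006, Cor. 1.6(i) p.19] -/
theorem rawLabel_comp (b : ι → Γ) (p q : Path (base ι) (base ι)) :
    rawLabel b (p.comp q) = rawLabel b q * rawLabel b p := by
  rw [rawLabel, cls_comp]
  exact (labelFunctor b).map_comp _ _

/-- The raw label of an excursion. [cite: MochizukiSemiAnbd2006, Cor. 1.6(i) p.19] -/
theorem rawLabel_excursion (b : ι → Γ) (i : ι) (s s' : Bool) :
    rawLabel b (excursion i s s') = (cond s' (b i) 1) * (cond s (b i) 1)⁻¹ := by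
  change (Paths.lift (Symmetrify.lift (labelPrefunctor b))).map
      (((Path.nil : Path (base ι) (base ι)).cons (inArrow i s)).cons (outArrow i s')) = _
  rw [Paths.lift_cons, Paths.lift_cons, Paths.lift_nil]
  exact (congrArg (· ≫ _) (Category.id_comp _)).trans rfl

/-- **The label homomorphism** `π₁(B_ι, ⋆) → Γ`: the inverse of the label functor on the vertex
group at `⋆` (the vertex group composes diagrammatically, `x * y = x ≫ y`, while `SingleObj Γ`
composes `f ≫ g = g * f`, so `x ↦ (L x)⁻¹` is the homomorphism reading labels along the path).
[cite: MochizukiSemiAnbd2006, Cor. 1.6(i) p.19] -/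
noncomputable def labelHom (b : ι → Γ) : (rose ι).FundamentalGroup (Sum.inl (vtx ι)) →* Γ where
  toFun x := ((labelFunctor b).map x : Γ)⁻¹
  map_one' := by
    have h : ((labelFunctor b).map (𝟙 ((rose ι).basept (Sum.inl (vtx ι)))) : Γ) = 1 :=
      CategoryTheory.Functor.map_id _ _
    exact (congrArg (·⁻¹) h).trans inv_one
  map_mul' x y := by
    have h : ((labelFunctor b).map (x ≫ y) : Γ) =
        ((labelFunctor b).map y : Γ) * ((labelFunctor b).map x : Γ) :=
      (labelFunctor b).map_comp x y
    exact (congrArg (·⁻¹) h).trans (mul_inv_rev _ _)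

/-- `labelHom` on the class of a closed path is the inverse raw label.
[cite: MochizukiSemiAnbd2006, Cor. 1.6(i) p.19] -/
theorem labelHom_cls (b : ι → Γ) (p : Path (base ι) (base ι)) :
    labelHom b (cls p) = (rawLabel b p)⁻¹ := rfl

/-- The label of an excursion. [cite: MochizukiSemiAnbd2006, Cor. 1.6(i) p.19] -/
theorem labelHom_cls_excursion (b : ι → Γ) (i : ι) (s s' : Bool) :
    labelHom b (cls (excursion i s s')) = (cond s (b i) 1) * (cond s' (b i) 1)⁻¹ := by
  rw [labelHom_cls, rawLabel_excursion, mul_inv_rev, inv_inv]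

/-- The label of the loop of the generator `i` is `b i`. [cite: MochizukiSemiAnbd2006, Cor. 1.6(i) p.19] -/
theorem labelHom_cls_loopPath (b : ι → Γ) (i : ι) : labelHom b (cls (loopPath i)) = b i := by
  rw [loopPath, labelHom_cls_excursion, Bool.cond_true, Bool.cond_false, inv_one, mul_one]

/-! ### Labels of arbitrary zigzag paths -/

/-- The label (in `Γ`) of a formal arrow of the symmetrised quiver: the branch label forwards, its
inverse backwards. [cite: MochizukiSemiAnbd2006, Cor. 1.6(i) p.19] -/
def arrowLabel (b : ι → Γ) : ∀ {X Y : Symmetrify (rose ι).CatCarrier}, (X ⟶ Y) → Γ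
  | _, _, Sum.inl x => (labelPrefunctor b).map x
  | _, _, Sum.inr x => ((labelPrefunctor b).map x)⁻¹

/-- The label of a zigzag path: the product of the labels of its arrows, the LAST arrow first
(anti-diagrammatic, matching `SingleObj Γ`). [cite: MochizukiSemiAnbd2006, Cor. 1.6(i) p.19] -/
def pathLabel (b : ι → Γ) {X : Symmetrify (rose ι).CatCarrier} :
    ∀ {Y : Symmetrify (rose ι).CatCarrier}, Path X Y → Γ
  | _, Path.nil => 1
  | _, Path.cons p f => arrowLabel b f * pathLabel b p

/-- The label of the empty path. [cite: MochizukiSemiAnbd2006, Cor. 1.6(i) p.19] -/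
@[simp] theorem pathLabel_nil (b : ι → Γ) (X : Symmetrify (rose ι).CatCarrier) :
    pathLabel b (Path.nil : Path X X) = 1 := rfl

/-- The label of an extended path. [cite: MochizukiSemiAnbd2006, Cor. 1.6(i) p.19] -/
@[simp] theorem pathLabel_cons (b : ι → Γ) {X Y Z : Symmetrify (rose ι).CatCarrier}
    (p : Path X Y) (f : Y ⟶ Z) : pathLabel b (p.cons f) = arrowLabel b f * pathLabel b p := rfl

/-- The label of a forward branch arrow. [cite: MochizukiSemiAnbd2006, Cor. 1.6(i) p.19] -/
@[simp] theorem arrowLabel_inl (b : ι → Γ) {X Y : (rose ι).CatCarrier} (x : X ⟶ Y) :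
    arrowLabel b (Sum.inl x : (Quiver.symmetrifyQuiver (rose ι).CatCarrier).Hom X Y) =
      (labelPrefunctor b).map x := rfl

/-- The label of a backward branch arrow. [cite: MochizukiSemiAnbd2006, Cor. 1.6(i) p.19] -/
@[simp] theorem arrowLabel_inr (b : ι → Γ) {X Y : (rose ι).CatCarrier} (x : X ⟶ Y) :
    arrowLabel b (Sum.inr x : (Quiver.symmetrifyQuiver (rose ι).CatCarrier).Hom Y X) =
      ((labelPrefunctor b).map x)⁻¹ := rfl

/-- The label functor on the class of one formal arrow is the arrow label.
[cite: MochizukiSemiAnbd2006, Cor. 1.6(i) p.19] -/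
theorem labelFunctor_map_homMk_toPath (b : ι → Γ) {X Y : Symmetrify (rose ι).CatCarrier}
    (f : X ⟶ Y) :
    ((labelFunctor b).map (homMk (V := (rose ι).CatCarrier) f.toPath) : Γ) = arrowLabel b f := by
  change (Paths.lift (Symmetrify.lift (labelPrefunctor b))).map f.toPath = _
  rw [Paths.lift_toPath]
  rcases f with x | x <;> rfl

/-- **The label functor computes the path label**: `L[p] = pathLabel p`.
[cite: MochizukiSemiAnbd2006, Cor. 1.6(i) p.19] -/
theorem labelFunctor_map_homMk (b : ι → Γ) {X : Symmetrify (rose ι).CatCarrier} :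
    ∀ {Y : Symmetrify (rose ι).CatCarrier} (p : Path X Y),
      ((labelFunctor b).map (homMk (V := (rose ι).CatCarrier) p) : Γ) = pathLabel b p
  | _, Path.nil => by
    rw [pathLabel_nil, homMk_nil]
    exact CategoryTheory.Functor.map_id _ _
  | _, Path.cons p f => by
    rw [pathLabel_cons, homMk_cons, Functor.map_comp, ← labelFunctor_map_homMk b p,
      ← labelFunctor_map_homMk_toPath b f]
    rfl

/-- `labelHom` on the class of a closed path is the inverse path label.
[cite: MochizukiSemiAnbd2006, Cor. 1.6(i) p.19] -/
theorem labelHom_cls_eq (b : ι → Γ) (p : Path (base ι) (base ι)) :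
    labelHom b (cls p) = (pathLabel b p)⁻¹ :=
  congrArg (·⁻¹) (labelFunctor_map_homMk b p)

section Basis

variable (bΓ : FreeGroupBasis ι Γ)

/-- **The loop homomorphism** `Γ → π₁(B_ι, ⋆)`: the generator `bΓ i` goes to the class of the loop
`i`. [cite: MochizukiSemiAnbd2006, Cor. 1.6(i) p.19] -/
noncomputable def loopHom : Γ →* (rose ι).FundamentalGroup (Sum.inl (vtx ι)) :=
  bΓ.lift fun i => cls (loopPath i)

/-- `loopHom` on a generator. [cite: MochizukiSemiAnbd2006, Cor. 1.6(i) p.19] -/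
theorem loopHom_basis (i : ι) : loopHom bΓ (bΓ i) = cls (loopPath i) := by
  change (FreeGroup.lift _) (bΓ.repr (bΓ i)) = _
  rw [FreeGroupBasis.repr_apply_coe, FreeGroup.lift_apply_of]

/-- `labelHom ∘ loopHom = id`. [cite: MochizukiSemiAnbd2006, Cor. 1.6(i) p.19] -/
theorem labelHom_comp_loopHom : (labelHom bΓ).comp (loopHom bΓ) = MonoidHom.id Γ :=
  bΓ.ext_hom _ _ fun i => by
    rw [MonoidHom.comp_apply, loopHom_basis, labelHom_cls_loopPath, MonoidHom.id_apply]

/-- `loopHom ∘ labelHom` fixes every excursion. [cite: MochizukiSemiAnbd2006, Cor. 1.6(i) p.19] -/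
theorem loopHom_labelHom_excursion (i : ι) (s s' : Bool) :
    loopHom bΓ (labelHom bΓ (cls (excursion i s s'))) = cls (excursion i s s') := by
  rw [labelHom_cls_excursion]
  cases s <;> cases s'
  · rw [Bool.cond_false, inv_one, mul_one, map_one, cls_excursion_self]
  · rw [Bool.cond_false, Bool.cond_true, one_mul, map_inv, loopHom_basis, loopPath,
      cls_excursion_symm i false true, inv_inv]
  · rw [Bool.cond_false, Bool.cond_true, inv_one, mul_one, loopHom_basis, loopPath]
  · rw [Bool.cond_true, mul_inv_cancel, map_one, cls_excursion_self]

/-- **Every closed zigzag path at `⋆` is empty or ends with an excursion** (the quiver `Cat(B_ι)`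
has arrows only from edge-objects to the vertex). [cite: MochizukiSemiAnbd2006, Cor. 1.6(i) p.19] -/
theorem path_decomp (p : Path (base ι) (base ι)) :
    p = Path.nil ∨ ∃ (q : Path (base ι) (base ι)) (i : ι) (s s' : Bool),
      p = q.comp (excursion i s s') := by
  cases p with
  | nil => exact Or.inl rfl
  | cons p f =>
    rename_i Y
    right
    rcases f with x | x
    · rcases Y with v | i
      · exact PEmpty.elim x
      · cases p with
        | cons q g =>
          rename_i Z
          rcases g with y | y
          · rcases Z with w | j <;> exact PEmpty.elim y
          · rcases Z with w | j
            · cases eq_vtx w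
              refine ⟨q, i, y.1.2, x.1.2, ?_⟩
              rw [arrow_eq i x, arrow_eq i y]
              rfl
            · exact PEmpty.elim y
    · rcases Y with v | i <;> exact PEmpty.elim x

/-- `loopHom ∘ labelHom = id` on the class of every closed path.
[cite: MochizukiSemiAnbd2006, Cor. 1.6(i) p.19] -/
theorem loopHom_labelHom_cls : ∀ (n : ℕ) (p : Path (base ι) (base ι)), p.length ≤ n →
    loopHom bΓ (labelHom bΓ (cls p)) = cls p
  | 0, p, hp => by
    obtain rfl : p = Path.nil := Path.eq_nil_of_length_zero p (Nat.le_zero.mp hp)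
    rw [cls_nil, map_one, map_one]
  | n + 1, p, hp => by
    rcases path_decomp p with rfl | ⟨q, i, s, s', rfl⟩
    · rw [cls_nil, map_one, map_one]
    · have hq : q.length ≤ n := by
        have := hp
        rw [Path.length_comp] at this
        change q.length + 2 ≤ n + 1 at this
        omega
      rw [cls_comp, map_mul, map_mul, loopHom_labelHom_cls n q hq, loopHom_labelHom_excursion]

/-- `loopHom ∘ labelHom = id`. [cite: MochizukiSemiAnbd2006, Cor. 1.6(i) p.19] -/
theorem loopHom_comp_labelHom :
    (loopHom bΓ).comp (labelHom bΓ) = MonoidHom.id _ := by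
  ext x
  obtain ⟨p, rfl⟩ := cls_surjective x
  exact loopHom_labelHom_cls bΓ p.length p le_rfl

/-- The label homomorphism is bijective. [cite: MochizukiSemiAnbd2006, Cor. 1.6(i) p.19] -/
theorem labelHom_bijective : Function.Bijective (labelHom bΓ) :=
  ⟨fun x y h => by
      have hx := DFunLike.congr_fun (loopHom_comp_labelHom bΓ) x
      have hy := DFunLike.congr_fun (loopHom_comp_labelHom bΓ) y
      rw [MonoidHom.comp_apply, MonoidHom.id_apply] at hx hy
      rw [← hx, ← hy, h],
    fun g => ⟨loopHom bΓ g, by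
      have := DFunLike.congr_fun (labelHom_comp_loopHom bΓ) g
      rwa [MonoidHom.comp_apply] at this⟩⟩

/-- **`π₁(B_ι, ⋆) ≅ Γ`**: the fundamental group of the bouquet on `ι` is the free group `Γ` with
basis indexed by `ι`, the class of the loop `i` corresponding to the basis element `bΓ i` (proof of
Cor. 1.6 (i): "`π₁(G_B) ≅ G`"). [cite: MochizukiSemiAnbd2006, Cor. 1.6(i) p.19] -/
noncomputable def fundamentalGroupEquiv :
    (rose ι).FundamentalGroup (Sum.inl (vtx ι)) ≃* Γ :=
  MulEquiv.ofBijective (labelHom bΓ) (labelHom_bijective bΓ)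

/-- The equivalence is the label homomorphism. [cite: MochizukiSemiAnbd2006, Cor. 1.6(i) p.19] -/
theorem fundamentalGroupEquiv_apply (x : (rose ι).FundamentalGroup (Sum.inl (vtx ι))) :
    fundamentalGroupEquiv bΓ x = labelHom bΓ x := rfl

end Basis

end Rose

end SemiGraph

end Literature.AnabelianGeometry.SemiGraphs
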